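import Summits.QuantumFields.YangMills.Theorems.F4SubCurvatureDoorSubCurvatureKernelReflectionPositivityRung
import HarnessLib

/-!
# Route `F4SubCurvatureDoor`, crux `SubCurvatureKernel` ⟨stmt-QuantumFields-23036⟩ — POINTWISE REFLECTION POSITIVITY of a continuous representing
# kernel from `RPPos` (clause 4 of the crux, modulo continuity)

Helper file (`--supports stmt-QuantumFields-23036 --as helper`; free-hands seat `ym-line-frs-p2` g17, soft-half scope).  Definition-free, 0 sorry, standard axioms.
No item is closed; no summit, no crux and no mass gap is proved by this file.

WHAT.  ★ `pointwise_rp_of_rpPos` (kernel-generic): if a one-field family `S₁` is reflection positive on positive-time off-diagonal tuples (`RPPos`) and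
its two-point functional is represented on compactly supported off-diagonal test functions by a real kernel `K` CONTINUOUS OFF `0`
(`S₁ 2 F = ∫ (K(y₀ − y₁) : ℂ) F`), then `K` is pointwise OS-positive-definite: `Σᵢⱼ cᵢcⱼ K(θxᵢ − xⱼ) ≥ 0` for points with `(xᵢ)₀ > 0` —
clause 4 of `SubCurvatureKernel`.  Proof: degree-one tuples `fᵢ = cᵢ · (normed bump of radius ε at xᵢ)`, `Hᵢⱼ = osAdjoint fᵢ ⊗ fⱼ`;
`RPPos` gives `0 ≤ Re Σ S₁ 2 Hᵢⱼ`; and `|S₁ 2 Hᵢⱼ − cᵢcⱼ K(θxᵢ − xⱼ)| ≤ η |cᵢcⱼ|` once `2ε` is below the continuity modulus of `K` at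
`θxᵢ − xⱼ ≠ 0` (an η-argument, no limits).  ★ `pointwise_rp_of_offDiagLimitAlong`: the same for every off-diagonal limit point of an
admissible leg scheme under `MomentBounds6` (via the normalisation of ✓p733252, `RPPos` there, and `S' 2 = S₁ 2`).

HONEST LABEL: clause 4 of the SOFT half GIVEN a continuous representing kernel; (C) continuity remains the open input; the SUB-CURVATURE clause is the crux,
untouched; ⟨23036⟩ open; the Yang–Mills mass gap is NOT proved; no summit is proved by a line.
-/

set_option autoImplicit false

noncomputable section

open scoped SchwartzMap BigOperators ComplexConjugate ContDiff
open MeasureTheory Filter Topology Set Metric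
open Literature.MathematicalPhysics.QuantumFieldTheory Literature.MathematicalPhysics.QuantumLattice
open Literature.MathematicalPhysics.AQFT
open Summit.QuantumFields.YangMills.Cruxes.OSLegsFromFemtoAndGap.DlrCollarTransfer (MomentBounds6 RPPos)
open Summit.QuantumFields.YangMills.Theorems.ROT (IsLegScheme OffDiagLimitAlong)
open Summit.QuantumFields.YangMills.Theorems.NPointIsotropy.Negative (E4)
open Summit.QuantumFields.YangMills.Theorems.F4SubCurvatureDoorSubCurvatureKernelRP (rpPos_normalize_of_offDiagLimitAlong)

namespace Summit.QuantumFields.YangMills.Theorems.F4SubCurvatureDoorSubCurvatureKernelPointwiseRP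

/-! ## Degree-one bump test functions -/

/-- The degree-one complex test function `y ↦ c · b(y 0)` built from a real smooth compactly supported `b : ℝ⁴ → ℝ`. [bookkeeping] -/
theorem exists_degOne (c : ℝ) (b : E4 → ℝ) (hbs : ContDiff ℝ ∞ b) (hbc : HasCompactSupport b) :
    ∃ f : 𝓢((Fin 1 → E4), ℂ), (∀ y, f y = ((c * b (y 0) : ℝ) : ℂ)) ∧ HasCompactSupport (f : (Fin 1 → E4) → ℂ) ∧
      tsupport (f : (Fin 1 → E4) → ℂ) ⊆ {y | y 0 ∈ tsupport b} := by
  have hs : ContDiff ℝ ∞ fun y : Fin 1 → E4 => ((c * b (y 0) : ℝ) : ℂ) :=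
    Complex.ofRealCLM.contDiff.comp (contDiff_const.mul (hbs.comp (contDiff_apply ℝ E4 0)))
  have hcomp : (fun y : Fin 1 → E4 => ((c * b (y 0) : ℝ) : ℂ)) = (fun u : E4 => ((c * b u : ℝ) : ℂ)) ∘ Homeomorph.funUnique (Fin 1) E4 := by
    funext y; rfl
  have hc : HasCompactSupport fun y : Fin 1 → E4 => ((c * b (y 0) : ℝ) : ℂ) := by
    rw [hcomp]
    exact ((hbc.mul_left (f := fun _ => c)).comp_left Complex.ofReal_zero).comp_homeomorph _
  refine ⟨hc.toSchwartzMap hs, fun y => rfl, hc, ?_⟩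
  refine closure_minimal (fun y hy => ?_) ((isClosed_tsupport b).preimage (continuous_apply 0))
  have hb : b (y 0) ≠ 0 := by
    intro h; apply hy; show ((c * b (y 0) : ℝ) : ℂ) = 0; simp [h]
  exact subset_tsupport _ hb

/-! ## ★ Pointwise reflection positivity -/

/-- ★ **POINTWISE RP OF A CONTINUOUS REPRESENTING KERNEL from `RPPos`.** [cite: OS1973, §2 (E2)] [cite: GlimmJaffe1987, §6.1] -/
theorem pointwise_rp_of_rpPos (S₁ : SchwingerFamily E4) (hRP : RPPos S₁) (K : E4 → ℝ) (hKc : ContinuousOn K {x : E4 | x ≠ 0})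
    (hrep : ∀ F : 𝓢((Fin 2 → E4), ℂ), IsOffDiagonal F → HasCompactSupport (F : (Fin 2 → E4) → ℂ) →
      Integrable (fun x : Fin 2 → E4 => (K (x 0 - x 1) : ℂ) * F x) ∧ S₁ 2 F = ∫ x : Fin 2 → E4, (K (x 0 - x 1) : ℂ) * F x)
    (m : ℕ) (x : Fin m → E4) (c : Fin m → ℝ) (hx : ∀ i, 0 < x i 0) :
    0 ≤ ∑ i, ∑ j, c i * c j * K (timeReflection 4 (x i) - x j) := by
  classical
  -- it suffices to show the sum is `≥ -η Σ|cᵢcⱼ|` for every `η > 0`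
  set Csum : ℝ := ∑ i, ∑ j, |c i * c j| with hCsum
  have hCsum0 : 0 ≤ Csum := Finset.sum_nonneg fun i _ => Finset.sum_nonneg fun j _ => abs_nonneg _
  suffices hη : ∀ η : ℝ, 0 < η → -(η * Csum) ≤ ∑ i, ∑ j, c i * c j * K (timeReflection 4 (x i) - x j) by
    by_contra hneg
    push Not at hneg
    by_cases hC : Csum = 0
    · have := hη 1 one_pos; rw [hC, mul_zero, neg_zero] at this; exact absurd this (not_le.2 hneg)
    · have hCpos : 0 < Csum := lt_of_le_of_ne hCsum0 (Ne.symm hC)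
      set s := ∑ i, ∑ j, c i * c j * K (timeReflection 4 (x i) - x j)
      have := hη (-s / (2 * Csum)) (by apply div_pos (by linarith) (by positivity))
      have h2 : -s / (2 * Csum) * Csum = -s / 2 := by field_simp
      rw [h2] at this
      linarith
  intro η hη
  -- the points `pᵢⱼ = θxᵢ − xⱼ ≠ 0` and a common continuity radius `δ`
  set θ := timeReflection 4 with hθ
  have hp_ne : ∀ i j, θ (x i) - x j ≠ 0 := by
    intro i j h
    have h0 : (θ (x i) - x j) 0 = 0 := by rw [h]; rfl
    rw [PiLp.sub_apply, hθ, timeReflection_apply] at h0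
    simp only [if_true] at h0
    linarith [hx i, hx j]
  have hδij : ∀ i j, ∃ δ : ℝ, 0 < δ ∧ ∀ w : E4, ‖w - (θ (x i) - x j)‖ < δ → |K w - K (θ (x i) - x j)| < η := by
    intro i j
    have hca : ContinuousAt K (θ (x i) - x j) := hKc.continuousAt (isOpen_ne.mem_nhds (hp_ne i j))
    obtain ⟨δ, hδ, h⟩ := Metric.continuousAt_iff.1 hca η hη
    exact ⟨δ, hδ, fun w hw => by have := h hw; rwa [Real.dist_eq] at this⟩
  choose δf hδf_pos hδf using hδij
  -- a radius `ε` below every `δᵢⱼ / 2` and every `(xᵢ)₀`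
  obtain ⟨ε, hε, hεδ, hεx⟩ : ∃ ε : ℝ, 0 < ε ∧ (∀ i j, 2 * ε < δf i j) ∧ ∀ i, ε < x i 0 := by
    rcases isEmpty_or_nonempty (Fin m) with hm | hm
    · exact ⟨1, one_pos, fun i => (IsEmpty.false i).elim, fun i => (IsEmpty.false i).elim⟩
    · set d1 : ℝ := (Finset.univ.image fun p : Fin m × Fin m => δf p.1 p.2).min' (by simp) with hd1
      set d2 : ℝ := (Finset.univ.image fun i : Fin m => x i 0).min' (by simp) with hd2
      have hd1le : ∀ i j, d1 ≤ δf i j := fun i j =>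
        Finset.min'_le _ _ (Finset.mem_image.2 ⟨(i, j), Finset.mem_univ _, rfl⟩)
      have hd2le : ∀ i, d2 ≤ x i 0 := fun i => Finset.min'_le _ _ (Finset.mem_image.2 ⟨i, Finset.mem_univ _, rfl⟩)
      have hd1pos : 0 < d1 := by
        obtain ⟨p, -, hp⟩ := Finset.mem_image.1 (Finset.min'_mem (Finset.univ.image fun p : Fin m × Fin m => δf p.1 p.2) (by simp))
        rw [hd1, ← hp]; exact hδf_pos _ _
      have hd2pos : 0 < d2 := by
        obtain ⟨i, -, hi⟩ := Finset.mem_image.1 (Finset.min'_mem (Finset.univ.image fun i : Fin m => x i 0) (by simp))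
        rw [hd2, ← hi]; exact hx i
      refine ⟨min (d1 / 4) (d2 / 2), by positivity, fun i j => ?_, fun i => ?_⟩
      · have := hd1le i j; have := min_le_left (d1 / 4) (d2 / 2); linarith
      · have := hd2le i; have := min_le_right (d1 / 4) (d2 / 2); linarith
  -- the bumps
  let bmp : (i : Fin m) → ContDiffBump (x i) := fun i => ⟨ε / 2, ε, by positivity, by linarith⟩
  set b : Fin m → E4 → ℝ := fun i => (bmp i).normed volume with hb
  have hb_s : ∀ i, ContDiff ℝ ∞ (b i) := fun i => (bmp i).contDiff_normed
  have hb_c : ∀ i, HasCompactSupport (b i) := fun i => (bmp i).hasCompactSupport_normed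
  have hb_0 : ∀ i u, 0 ≤ b i u := fun i u => (bmp i).nonneg_normed u
  have hb_1 : ∀ i, ∫ u, b i u = 1 := fun i => (bmp i).integral_normed
  have hb_supp : ∀ i u, b i u ≠ 0 → ‖u - x i‖ < ε := by
    intro i u hu
    have : u ∈ Function.support (b i) := hu
    rw [hb, ContDiffBump.support_normed_eq] at this
    simpa [dist_eq_norm] using this
  have hb_tsupp : ∀ i, tsupport (b i) ⊆ Metric.closedBall (x i) ε := fun i => by
    rw [hb, ContDiffBump.tsupport_normed_eq]
  -- the degree-one test functions
  have hf := fun i => exists_degOne (c i) (b i) (hb_s i) (hb_c i)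
  choose f hf_apply hf_c hf_supp using hf
  have hf_pos : ∀ i, IsPositiveTimeMulti (f i) := by
    intro i y hy k
    have hy0 : y 0 ∈ Metric.closedBall (x i) ε := hb_tsupp i (hf_supp i hy)
    rw [Subsingleton.elim k 0]
    have h1 : |(y 0 - x i) 0| ≤ ‖y 0 - x i‖ := by
      simpa [Real.norm_eq_abs] using PiLp.norm_apply_le (p := 2) (y 0 - x i) 0
    rw [mem_closedBall, dist_eq_norm] at hy0
    rw [PiLp.sub_apply] at h1
    have := abs_le.1 (h1.trans hy0)
    linarith [hεx i, this.1]
  have hf_off : ∀ i, IsOffDiagonal (f i) := fun i y hy k => by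
    obtain ⟨a, a', haa', -⟩ := (mem_coincidenceLocus y).1 hy
    exact absurd (Subsingleton.elim a a') haa'
  -- the OS products
  set H : Fin m → Fin m → 𝓢((Fin (1 + 1) → E4), ℂ) := fun i j => SchwartzMap.appendTensor (osAdjoint (f i)) (f j) with hH
  have hH_app : ∀ i j, IsAppendTensorOf (H i j) (osAdjoint (f i)) (f j) := fun i j => isAppendTensorOf_appendTensor _ _
  have hH_val : ∀ i j (y : Fin 2 → E4), H i j y = ((c i * b i (θ (y 0)) * (c j * b j (y 1)) : ℝ) : ℂ) := by
    intro i j y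
    have h := hH_app i j y
    rw [h, osAdjoint_apply, hf_apply, hf_apply]
    push_cast
    simp only [Complex.conj_ofReal, map_mul]
    congr 1
  -- support, compact support and off-diagonality of `H i j`
  have hH_ne : ∀ i j (y : Fin 2 → E4), H i j y ≠ 0 → ‖θ (y 0) - x i‖ < ε ∧ ‖y 1 - x j‖ < ε := by
    intro i j y hy
    rw [hH_val] at hy
    have h1 : b i (θ (y 0)) ≠ 0 := by intro h; apply hy; simp [h]
    have h2 : b j (y 1) ≠ 0 := by intro h; apply hy; simp [h]
    exact ⟨hb_supp i _ h1, hb_supp j _ h2⟩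
  have hH_c : ∀ i j, HasCompactSupport (H i j : (Fin 2 → E4) → ℂ) := by
    intro i j
    set A : Set E4 := (θ : E4 → E4) ⁻¹' Metric.closedBall (x i) ε with hA
    have hAc : IsCompact A := (θ.toHomeomorph.isCompact_preimage).2 (isCompact_closedBall _ _)
    set S : Set (Fin 2 → E4) := (Homeomorph.piFinTwo fun _ : Fin 2 => E4) ⁻¹' (A ×ˢ Metric.closedBall (x j) ε) with hS
    have hSc : IsCompact S := ((Homeomorph.piFinTwo fun _ : Fin 2 => E4).isCompact_preimage).2 (hAc.prod (isCompact_closedBall _ _))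
    refine HasCompactSupport.intro hSc fun y hy => ?_
    by_contra hne
    obtain ⟨h1, h2⟩ := hH_ne i j y hne
    apply hy
    show (y 0, y 1) ∈ A ×ˢ Metric.closedBall (x j) ε
    refine Set.mk_mem_prod ?_ ?_
    · show θ (y 0) ∈ Metric.closedBall (x i) ε
      rw [Metric.mem_closedBall, dist_eq_norm]; exact h1.le
    · rw [Metric.mem_closedBall, dist_eq_norm]; exact h2.le
  have hH_off : ∀ i j, IsOffDiagonal (show 𝓢((Fin 2 → E4), ℂ) from H i j) := by
    intro i j
    refine IsOffDiagonal.of_tsupport_subset fun y hy hco => ?_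
    obtain ⟨a, a', haa', hya⟩ := (mem_coincidenceLocus y).1 hco
    have h01 : y 0 = y 1 := by
      fin_cases a <;> fin_cases a'
      · exact absurd rfl haa'
      · exact hya
      · exact hya.symm
      · exact absurd rfl haa'
    -- on the support the time of `y 0` is negative and the time of `y 1` is positive
    have hcl : tsupport (H i j : (Fin 2 → E4) → ℂ) ⊆ {y | (y 0) 0 ≤ -(x i 0) + ε ∧ x j 0 - ε ≤ (y 1) 0} := by
      refine closure_minimal (fun z hz => ?_) ?_
      · obtain ⟨h1, h2⟩ := hH_ne i j z hz
        have e1 : |(θ (z 0) - x i) 0| ≤ ‖θ (z 0) - x i‖ := by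
          simpa [Real.norm_eq_abs] using PiLp.norm_apply_le (p := 2) (θ (z 0) - x i) 0
        have e2 : |(z 1 - x j) 0| ≤ ‖z 1 - x j‖ := by
          simpa [Real.norm_eq_abs] using PiLp.norm_apply_le (p := 2) (z 1 - x j) 0
        rw [PiLp.sub_apply, hθ, timeReflection_apply] at e1
        simp only [if_true] at e1
        rw [PiLp.sub_apply] at e2
        constructor
        · have := (abs_le.1 (e1.trans h1.le)).1; linarith
        · have := (abs_le.1 (e2.trans h2.le)).1; linarith
      · have hc0 : Continuous fun y : Fin 2 → E4 => (y 0) 0 :=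
          (EuclideanSpace.proj (0 : Fin 4) : E4 →L[ℝ] ℝ).continuous.comp (continuous_apply 0)
        have hc1 : Continuous fun y : Fin 2 → E4 => (y 1) 0 :=
          (EuclideanSpace.proj (0 : Fin 4) : E4 →L[ℝ] ℝ).continuous.comp (continuous_apply 1)
        exact (isClosed_le hc0 continuous_const).inter (isClosed_le continuous_const hc1)
    have h := hcl hy
    simp only [mem_setOf_eq] at h
    rw [h01] at h
    linarith [h.1, h.2, hεx i, hεx j]
  -- RPPos
  have hz := hRP m (fun _ => 1) f hf_pos hf_off H hH_app
  -- each term is close to `cᵢcⱼ K(pᵢⱼ)`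
  have hterm : ∀ i j, ‖S₁ 2 (H i j) - (c i : ℂ) * (c j : ℂ) * (K (θ (x i) - x j) : ℂ)‖ ≤ η * |c i * c j| := by
    intro i j
    obtain ⟨hI, hS⟩ := hrep (H i j) (hH_off i j) (hH_c i j)
    -- `∫ H = cᵢ cⱼ`
    have hHi : Integrable (fun y : Fin 2 → E4 => H i j y) := (H i j).continuous.integrable_of_hasCompactSupport (hH_c i j)
    have hprod : ∀ (g₁ g₂ : E4 → ℝ), Integrable g₁ → Integrable g₂ →
        ∫ y : Fin 2 → E4, g₁ (θ (y 0)) * g₂ (y 1) = (∫ u, g₁ u) * ∫ u, g₂ u := by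
      intro g₁ g₂ hg₁ hg₂
      have h1 : ∫ y : Fin 2 → E4, g₁ (θ (y 0)) * g₂ (y 1) = ∫ p : E4 × E4, g₁ (θ p.1) * g₂ p.2 :=
        (volume_preserving_finTwoArrow E4).integral_comp' (f := MeasurableEquiv.finTwoArrow) (fun p : E4 × E4 => g₁ (θ p.1) * g₂ p.2)
      rw [h1, show (volume : Measure (E4 × E4)) = volume.prod volume from rfl, integral_prod_mul (fun u => g₁ (θ u)) g₂]
      congr 1
      exact (θ.measurePreserving).integral_comp θ.toMeasurableEquiv.measurableEmbedding g₁
    have hintH : ∫ y : Fin 2 → E4, H i j y = ((c i * c j : ℝ) : ℂ) := by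
      have h1 : ∫ y : Fin 2 → E4, H i j y = ∫ y : Fin 2 → E4, (((c i * b i (θ (y 0))) * (c j * b j (y 1)) : ℝ) : ℂ) :=
        integral_congr_ae (Eventually.of_forall fun y => hH_val i j y)
      rw [h1, integral_complex_ofReal]
      congr 1
      have h2 := hprod (fun u => c i * b i u) (fun u => c j * b j u)
        (((bmp i).integrable_normed).const_mul _) (((bmp j).integrable_normed).const_mul _)
      rw [h2, integral_const_mul, integral_const_mul, hb_1, hb_1]; ring
    -- the difference as one integral
    have hdiff : S₁ 2 (H i j) - (c i : ℂ) * (c j : ℂ) * (K (θ (x i) - x j) : ℂ) =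
        ∫ y : Fin 2 → E4, (((K (y 0 - y 1) : ℂ) - (K (θ (x i) - x j) : ℂ)) * H i j y) := by
      rw [hS]
      have h1 : (c i : ℂ) * (c j : ℂ) * (K (θ (x i) - x j) : ℂ) = ∫ y : Fin 2 → E4, (K (θ (x i) - x j) : ℂ) * H i j y := by
        rw [integral_const_mul, hintH]; push_cast; ring
      rw [h1, ← integral_sub hI (hHi.const_mul _)]
      refine integral_congr_ae (Eventually.of_forall fun y => ?_)
      ring
    rw [hdiff]
    -- pointwise bound on the support
    have hpt : ∀ y : Fin 2 → E4, ‖((K (y 0 - y 1) : ℂ) - (K (θ (x i) - x j) : ℂ)) * H i j y‖ ≤ η * ‖H i j y‖ := by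
      intro y
      rw [norm_mul]
      by_cases hy : H i j y = 0
      · simp [hy]
      · refine mul_le_mul_of_nonneg_right ?_ (norm_nonneg _)
        obtain ⟨h1, h2⟩ := hH_ne i j y hy
        have hw : ‖(y 0 - y 1) - (θ (x i) - x j)‖ < δf i j := by
          have e : (y 0 - y 1) - (θ (x i) - x j) = θ (θ (y 0) - x i) - (y 1 - x j) := by
            rw [map_sub, hθ, timeReflection_timeReflection]; abel
          rw [e]
          calc ‖θ (θ (y 0) - x i) - (y 1 - x j)‖ ≤ ‖θ (θ (y 0) - x i)‖ + ‖y 1 - x j‖ := norm_sub_le _ _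
            _ = ‖θ (y 0) - x i‖ + ‖y 1 - x j‖ := by rw [LinearIsometryEquiv.norm_map]
            _ < ε + ε := add_lt_add h1 h2
            _ = 2 * ε := by ring
            _ < δf i j := hεδ i j
        have := hδf i j _ hw
        rw [← Complex.ofReal_sub, Complex.norm_real, Real.norm_eq_abs]
        exact this.le
    have hnormH : ∫ y : Fin 2 → E4, ‖H i j y‖ = |c i * c j| := by
      have h1 : ∫ y : Fin 2 → E4, ‖H i j y‖ = ∫ y : Fin 2 → E4, (|c i| * b i (θ (y 0))) * (|c j| * b j (y 1)) := by
        refine integral_congr_ae (Eventually.of_forall fun y => ?_)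
        beta_reduce
        rw [hH_val, Complex.norm_real, Real.norm_eq_abs, abs_mul, abs_mul, abs_mul, abs_of_nonneg (hb_0 i _),
          abs_of_nonneg (hb_0 j _)]
      rw [h1, hprod (fun u => |c i| * b i u) (fun u => |c j| * b j u)
        (((bmp i).integrable_normed).const_mul _) (((bmp j).integrable_normed).const_mul _),
        integral_const_mul, integral_const_mul, hb_1, hb_1, abs_mul]; ring
    calc ‖∫ y : Fin 2 → E4, ((K (y 0 - y 1) : ℂ) - (K (θ (x i) - x j) : ℂ)) * H i j y‖
        ≤ ∫ y : Fin 2 → E4, η * ‖H i j y‖ := norm_integral_le_of_norm_le (hHi.norm.const_mul η) (Eventually.of_forall hpt)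
      _ = η * |c i * c j| := by rw [integral_const_mul, hnormH]
  -- sum up
  have hsum : ‖(∑ i, ∑ j, S₁ 2 (H i j)) - ((∑ i, ∑ j, c i * c j * K (θ (x i) - x j) : ℝ) : ℂ)‖ ≤ η * Csum := by
    push_cast
    rw [← Finset.sum_sub_distrib]
    refine (norm_sum_le _ _).trans ?_
    rw [hCsum, Finset.mul_sum]
    refine Finset.sum_le_sum fun i _ => ?_
    rw [← Finset.sum_sub_distrib, Finset.mul_sum]
    exact (norm_sum_le _ _).trans (Finset.sum_le_sum fun j _ => hterm i j)
  have hre : 0 ≤ (∑ i, ∑ j, S₁ 2 (H i j)).re := hz.1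
  have hkey := (Complex.abs_re_le_norm _).trans hsum
  rw [Complex.sub_re, Complex.ofReal_re] at hkey
  have := (abs_le.1 hkey).2
  linarith

/-! ## Leg-scheme limit points -/

variable {G : Type} [Group G] [TopologicalSpace G] [IsTopologicalGroup G] [CompactSpace G]
  [MeasurableSpace G] [BorelSpace G]

/-- ★ **Clause 4 for leg-scheme limit points, given a continuous representing kernel**: under `MomentBounds6`, for every off-diagonal limit point `S₁`
and every real kernel `K` CONTINUOUS OFF `0` representing `S₁ 2` on compactly supported off-diagonal test functions, `K` is pointwise OS-positive-definite.
[cite: OS1973, §2 (E2)] [cite: OsterwalderSeiler1978, §3] -/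
theorem pointwise_rp_of_offDiagLimitAlong (r : LatticeRep G) {a : ℝ → ℝ} (hapos : ∀ β, 0 < a β)
    (ha0 : Tendsto a atTop (𝓝 0)) (hMB : MomentBounds6 G r a) {sch : SpeciesScheme (YMSpecies G)}
    (hsch : IsLegScheme a sch) {φ : ℕ → ℕ} (hφ : Tendsto φ atTop atTop) {S₁ : SchwingerFamily E4}
    (hS₁ : OffDiagLimitAlong r sch φ S₁) (K : E4 → ℝ) (hKc : ContinuousOn K {x : E4 | x ≠ 0})
    (hrep : ∀ F : 𝓢((Fin 2 → E4), ℂ), IsOffDiagonal F → HasCompactSupport (F : (Fin 2 → E4) → ℂ) →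
      Integrable (fun x : Fin 2 → E4 => (K (x 0 - x 1) : ℂ) * F x) ∧ S₁ 2 F = ∫ x : Fin 2 → E4, (K (x 0 - x 1) : ℂ) * F x)
    (m : ℕ) (x : Fin m → E4) (c : Fin m → ℝ) (hx : ∀ i, 0 < x i 0) :
    0 ≤ ∑ i, ∑ j, c i * c j * K (timeReflection 4 (x i) - x j) := by
  obtain ⟨S', -, hS'eq, -, hRP⟩ := rpPos_normalize_of_offDiagLimitAlong r hapos ha0 hMB hsch hφ hS₁
  have h2 : S' 2 = S₁ 2 := hS'eq 2 (by norm_num)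
  refine pointwise_rp_of_rpPos S' hRP K hKc (fun F hF hFc => ?_) m x c hx
  rw [h2]; exact hrep F hF hFc

end Summit.QuantumFields.YangMills.Theorems.F4SubCurvatureDoorSubCurvatureKernelPointwiseRP

end
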